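import Summits.QuantumAdvantage.AdviceFreeQNC0.CubeTwoCharacters
import HarnessLib

/-!
# Cell qa-qnc0 (rung F-Q1, route RingFrame, crux α, line `product`): `CubeCover` at `D = 2`, part 2/4 —
# the six-condition pair count `P(x,y)` and its asymptotics

`P(x, y) = #{(q₁, q₂) : q₁, q₂, q₁⊕q₂⊕x, q₁⊕x⊕y, q₂⊕x⊕y, q₁⊕q₂⊕y ∈ cls_r}` (`pairCount`) satisfies
`|729·P(x,y) − 4^L| ≤ 729·(E₁(x,y) + E₂(x,y))` with `E₁ = Π_j (3 if x_j ≠ y_j else 4)`,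
`E₂ = Π_j (4 if x_j ≠ y_j else 3)`, `Σ_y E₁ = Σ_y E₂ = 7^L` (`abs_pairCount_sub_le`, `sum_errA`,
`sum_errB`): the product formula of part 1 for the six vertex maps `bit6`, plus a 2916-case `decide`
(`key6`) showing that for a non-trivial character `t ∈ (ℤ/3)⁶` the exponents at coordinate `j` are
non-constant at every `j` with `x_j ≠ y_j` if `t` is "paired" (`t₀+t₃ ≡ t₁+t₄ ≡ t₂+t₅ ≡ 0`) and at
every `j` with `x_j = y_j` otherwise.  Also the pointwise xor identities (`x3_*`) used by the
re-parametrisations of part 3.  See `WeightClassCubes.lean`.  WHAT THIS IS NOT: nothing on α.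
[folklore]
-/
noncomputable section

namespace Summit.QuantumAdvantage.AdviceFreeQNC0

open Finset
open Literature.Computability.MetaComplexity.Hegedus

-- the machinery of the `D = 2` cube count lives in its own namespace `CubeTwo`.
namespace CubeTwo

variable {L : ℕ}

/-! ### The six vertex maps of a rooted 3-cube and their character exponents -/

/-- `a ⊕ b ⊕ c` coordinatewise. [folklore] -/
def x3 (a b c : Fin L → Bool) : Fin L → Bool := fun j => xor (xor (a j) (b j)) (c j)

/-- The six non-base conditions of a rooted cube, as bit maps of the pair `(q₁ j, q₂ j)`:
`q₁, q₂, q₁⊕q₂⊕x, q₁⊕x⊕y, q₂⊕x⊕y, q₁⊕q₂⊕y`. -/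
def bit6 (x y : Fin L → Bool) : Fin 6 → Fin L → Bool × Bool → Bool :=
  ![fun _ β => β.1, fun _ β => β.2, fun j β => xor (xor β.1 β.2) (x j),
    fun j β => xor (xor β.1 (x j)) (y j), fun j β => xor (xor β.2 (x j)) (y j),
    fun j β => xor (xor β.1 β.2) (y j)]

/-- The per-coordinate exponent of `bit6` with the character `t` spelled out. -/
def e6 (a₀ a₁ a₂ a₃ a₄ a₅ : ℕ) (xb yb : Bool) (β : Bool × Bool) : ℕ :=
  a₀ * (if β.1 = true then 1 else 0) + a₁ * (if β.2 = true then 1 else 0) +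
    a₂ * (if xor (xor β.1 β.2) xb = true then 1 else 0) +
    a₃ * (if xor (xor β.1 xb) yb = true then 1 else 0) +
    a₄ * (if xor (xor β.2 xb) yb = true then 1 else 0) +
    a₅ * (if xor (xor β.1 β.2) yb = true then 1 else 0)

/-- the exponents of the six cube-vertex maps are given by `e6`. [folklore] -/
theorem expo_bit6 (x y : Fin L → Bool) (t : Fin 6 → Fin 3) (j : Fin L) (β : Bool × Bool) :
    expo (bit6 x y) t j β = e6 (t 0) (t 1) (t 2) (t 3) (t 4) (t 5) (x j) (y j) β := by
  unfold expo e6 bit6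
  rw [Fin.sum_univ_six]
  simp

/-- the character is "conjugate-paired": `a₃ = −a₀, a₄ = −a₁, a₅ = −a₂ (mod 3)` (Boolean test). -/
def pairedB (a₀ a₁ a₂ a₃ a₄ a₅ : ℕ) : Bool :=
  decide ((a₀ + a₃) % 3 = 0) && decide ((a₁ + a₄) % 3 = 0) && decide ((a₂ + a₅) % 3 = 0)

/-- the exponent is constant mod 3 on the four bit pairs (Boolean test). -/
def econstB (a₀ a₁ a₂ a₃ a₄ a₅ : ℕ) (xb yb : Bool) : Bool :=
  decide (e6 a₀ a₁ a₂ a₃ a₄ a₅ xb yb (false, false) % 3 = e6 a₀ a₁ a₂ a₃ a₄ a₅ xb yb (true, false) % 3) &&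
  decide (e6 a₀ a₁ a₂ a₃ a₄ a₅ xb yb (false, false) % 3 = e6 a₀ a₁ a₂ a₃ a₄ a₅ xb yb (false, true) % 3) &&
  decide (e6 a₀ a₁ a₂ a₃ a₄ a₅ xb yb (false, false) % 3 = e6 a₀ a₁ a₂ a₃ a₄ a₅ xb yb (true, true) % 3)

set_option synthInstance.maxHeartbeats 400000 in
set_option synthInstance.maxSize 4096 in
/-- **Non-degeneracy (finite check over the `3^6` characters).** For a non-trivial character: if it
is conjugate-paired, the exponent is non-constant on every coordinate where `x` and `y` differ; if
it is not, on every coordinate where they agree. [folklore] -/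
theorem key6 : ∀ a₀ a₁ a₂ a₃ a₄ a₅ : Fin 3, ∀ xb yb : Bool,
    (a₀ = 0 ∧ a₁ = 0 ∧ a₂ = 0 ∧ a₃ = 0 ∧ a₄ = 0 ∧ a₅ = 0) ∨
    ((xb != yb && pairedB a₀ a₁ a₂ a₃ a₄ a₅) || (xb == yb && !pairedB a₀ a₁ a₂ a₃ a₄ a₅)) = false ∨
    econstB a₀ a₁ a₂ a₃ a₄ a₅ xb yb = false := by
  decide

/-! ### Per-coordinate and per-character bounds -/

/-- every coordinate factor has norm at most `4`. [folklore] -/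
theorem norm_factor_le_four {K : ℕ} (bit : Fin K → Fin L → Bool × Bool → Bool) (t : Fin K → Fin 3)
    (j : Fin L) : ‖factor bit t j‖ ≤ 4 :=
  norm_sum_omega3_pow_le_four _

/-- the trivial character has all coordinate factors equal to `4`. [folklore] -/
theorem factor_zero {K : ℕ} (bit : Fin K → Fin L → Bool × Bool → Bool) (j : Fin L) :
    factor bit 0 j = 4 := by
  unfold factor expo
  simp only [Pi.zero_apply, Fin.val_zero, zero_mul, Finset.sum_const_zero, pow_zero]
  rw [Finset.sum_const, Finset.card_univ, Fintype.card_prod, Fintype.card_bool]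
  norm_num

/-- a coordinate factor with non-constant exponents has norm at most `3`. [folklore] -/
theorem norm_factor_bit6_le_three (x y : Fin L → Bool) (t : Fin 6 → Fin 3) (j : Fin L)
    (h : econstB (t 0) (t 1) (t 2) (t 3) (t 4) (t 5) (x j) (y j) = false) :
    ‖factor (bit6 x y) t j‖ ≤ 3 := by
  unfold factor
  simp_rw [expo_bit6]
  refine norm_sum_omega3_pow_le_three _ ?_
  rintro ⟨h1, h2, h3⟩
  unfold econstB at h
  rw [decide_eq_true h1, decide_eq_true h2, decide_eq_true h3] at h
  exact Bool.noConfusion h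

/-- error products: `E₁(x,y) = Π_j (3 if xⱼ ≠ yⱼ else 4)`, `E₂(x,y) = Π_j (4 if xⱼ ≠ yⱼ else 3)`. -/
def errA (x y : Fin L → Bool) : ℝ := ∏ j, (if xor (x j) (y j) = true then (3 : ℝ) else 4)

/-- error product `E₂(x,y) = Π_j (4 if xⱼ ≠ yⱼ else 3)`. [folklore] -/
def errB (x y : Fin L → Bool) : ℝ := ∏ j, (if xor (x j) (y j) = true then (4 : ℝ) else 3)

/-- `0 ≤ E₁`. [folklore] -/
theorem errA_nonneg (x y : Fin L → Bool) : 0 ≤ errA x y :=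
  Finset.prod_nonneg fun j _ => by split_ifs <;> norm_num

/-- `0 ≤ E₂`. [folklore] -/
theorem errB_nonneg (x y : Fin L → Bool) : 0 ≤ errB x y :=
  Finset.prod_nonneg fun j _ => by split_ifs <;> norm_num

/-- `Σ_y E₁(x,y) = 7^L`. [folklore] -/
theorem sum_errA (x : Fin L → Bool) : ∑ y : Fin L → Bool, errA x y = 7 ^ L := by
  unfold errA
  have e := sum_comp_xorLeft x (fun z : Fin L → Bool => ∏ j, if z j = true then (3 : ℝ) else 4)
  beta_reduce at e
  rw [e, sum_prod_ite_eq_add_pow]; norm_num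

/-- `Σ_y E₂(x,y) = 7^L`. [folklore] -/
theorem sum_errB (x : Fin L → Bool) : ∑ y : Fin L → Bool, errB x y = 7 ^ L := by
  unfold errB
  have e := sum_comp_xorLeft x (fun z : Fin L → Bool => ∏ j, if z j = true then (4 : ℝ) else 3)
  beta_reduce at e
  rw [e, sum_prod_ite_eq_add_pow]; norm_num

/-- a character with all six components zero is the trivial character. [folklore] -/
theorem eq_zero_of_apply (t : Fin 6 → Fin 3)
    (h : t 0 = 0 ∧ t 1 = 0 ∧ t 2 = 0 ∧ t 3 = 0 ∧ t 4 = 0 ∧ t 5 = 0) : t = 0 := by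
  obtain ⟨h0, h1, h2, h3, h4, h5⟩ := h
  funext κ
  fin_cases κ <;> assumption

/-- For a non-trivial character the product of the coordinate factors is at most `E₁ + E₂`. -/
theorem prod_norm_factor_bit6_le (x y : Fin L → Bool) (t : Fin 6 → Fin 3) (ht : t ≠ 0) :
    ∏ j, ‖factor (bit6 x y) t j‖ ≤ errA x y + errB x y := by
  have hA := errA_nonneg x y
  have hB := errB_nonneg x y
  by_cases hp : pairedB (t 0) (t 1) (t 2) (t 3) (t 4) (t 5) = true
  · -- paired: coordinates with `x j ≠ y j` cancel
    have hle : ∏ j, ‖factor (bit6 x y) t j‖ ≤ errA x y := by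
      unfold errA
      refine Finset.prod_le_prod (fun j _ => norm_nonneg _) fun j _ => ?_
      by_cases hj : xor (x j) (y j) = true
      · rw [if_pos hj]
        refine norm_factor_bit6_le_three x y t j ?_
        rcases key6 (t 0) (t 1) (t 2) (t 3) (t 4) (t 5) (x j) (y j) with h0 | hc | he
        · exact (ht (eq_zero_of_apply t h0)).elim
        · exfalso
          have hne : (x j != y j) = true := by
            revert hj; cases x j <;> cases y j <;> decide
          rw [hne, hp] at hc
          simp at hc
        · exact he
      · rw [if_neg hj]
        exact norm_factor_le_four _ _ _
    linarith
  · have hp' : pairedB (t 0) (t 1) (t 2) (t 3) (t 4) (t 5) = false := by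
      simpa using hp
    have hle : ∏ j, ‖factor (bit6 x y) t j‖ ≤ errB x y := by
      unfold errB
      refine Finset.prod_le_prod (fun j _ => norm_nonneg _) fun j _ => ?_
      by_cases hj : xor (x j) (y j) = true
      · rw [if_pos hj]
        exact norm_factor_le_four _ _ _
      · rw [if_neg hj]
        refine norm_factor_bit6_le_three x y t j ?_
        rcases key6 (t 0) (t 1) (t 2) (t 3) (t 4) (t 5) (x j) (y j) with h0 | hc | he
        · exact (ht (eq_zero_of_apply t h0)).elim
        · exfalso
          have heq : (x j == y j) = true := by
            revert hj; cases x j <;> cases y j <;> decide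
          rw [heq, hp'] at hc
          simp at hc
        · exact he
    linarith

/-! ### The six-condition pair count `P(x,y)` and its asymptotics -/

/-- `P(x,y) = #{(q₁,q₂) : q₁, q₂, q₁⊕q₂⊕x, q₁⊕x⊕y, q₂⊕x⊕y, q₁⊕q₂⊕y ∈ cls_r}`. -/
def pairCount (x y : Fin L → Bool) (r : ℕ) : ℕ :=
  ∑ q₁ : Fin L → Bool, ∑ q₂ : Fin L → Bool,
    if wt q₁ % 3 = r % 3 ∧ wt q₂ % 3 = r % 3 ∧ wt (x3 q₁ q₂ x) % 3 = r % 3 ∧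
        wt (x3 q₁ x y) % 3 = r % 3 ∧ wt (x3 q₂ x y) % 3 = r % 3 ∧ wt (x3 q₁ q₂ y) % 3 = r % 3
      then 1 else 0

/-- the six vertex conditions, unfolded. [folklore] -/
theorem forall_bit6_iff (x y : Fin L → Bool) (r : ℕ) (q : Fin L → Bool × Bool) :
    (∀ κ : Fin 6, wt (vtx (bit6 x y) κ q) % 3 = r % 3) ↔
      (wt (fun j => (q j).1) % 3 = r % 3 ∧ wt (fun j => (q j).2) % 3 = r % 3 ∧
        wt (x3 (fun j => (q j).1) (fun j => (q j).2) x) % 3 = r % 3 ∧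
        wt (x3 (fun j => (q j).1) x y) % 3 = r % 3 ∧ wt (x3 (fun j => (q j).2) x y) % 3 = r % 3 ∧
        wt (x3 (fun j => (q j).1) (fun j => (q j).2) y) % 3 = r % 3) := by
  constructor
  · intro h
    exact ⟨h 0, h 1, h 2, h 3, h 4, h 5⟩
  · rintro ⟨h0, h1, h2, h3, h4, h5⟩ κ
    fin_cases κ
    · exact h0
    · exact h1
    · exact h2
    · exact h3
    · exact h4
    · exact h5

/-- `P(x,y)` in the shape of the product formula. -/
theorem pairCount_eq_sum (x y : Fin L → Bool) (r : ℕ) :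
    (pairCount x y r : ℂ) = ∑ q : Fin L → Bool × Bool,
      (if ∀ κ : Fin 6, wt (vtx (bit6 x y) κ q) % 3 = r % 3 then (1 : ℂ) else 0) := by
  unfold pairCount
  push_cast
  rw [← Fintype.sum_prod_type']
  rw [← Equiv.sum_comp (Equiv.arrowProdEquivProdArrow (Fin L) (fun _ => Bool) fun _ => Bool)]
  refine Finset.sum_congr rfl fun q _ => ?_
  simp only [Equiv.arrowProdEquivProdArrow_apply]
  by_cases h : ∀ κ : Fin 6, wt (vtx (bit6 x y) κ q) % 3 = r % 3
  · rw [if_pos h, if_pos ((forall_bit6_iff x y r q).1 h)]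
  · rw [if_neg h, if_neg fun h' => h ((forall_bit6_iff x y r q).2 h')]

/-- **Pair-count asymptotics.** `|729·P(x,y) − 4^L| ≤ 729·(E₁(x,y) + E₂(x,y))`. [folklore] -/
theorem abs_pairCount_sub_le (x y : Fin L → Bool) (r : ℕ) :
    |729 * (pairCount x y r : ℝ) - 4 ^ L| ≤ 729 * (errA x y + errB x y) := by
  have H := three_pow_mul_count_eq (bit6 x y) r
  rw [← pairCount_eq_sum] at H
  set g : (Fin 6 → Fin 3) → ℂ := fun t =>
    omega3 ^ (2 * r * ∑ κ, (t κ : ℕ)) * ∏ j : Fin L, factor (bit6 x y) t j with hg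
  have hsplit := Finset.add_sum_erase (univ : Finset (Fin 6 → Fin 3)) g (Finset.mem_univ 0)
  have g0 : g 0 = 4 ^ L := by
    simp only [hg, Pi.zero_apply, Fin.val_zero, Finset.sum_const_zero, mul_zero, pow_zero, one_mul,
      factor_zero, Finset.prod_const, Finset.card_univ, Fintype.card_fin]
  have hdiff : (3 : ℂ) ^ 6 * (pairCount x y r : ℂ) - 4 ^ L = ∑ t ∈ univ.erase 0, g t := by
    rw [H, ← hsplit, g0]; ring
  have hnorm : ‖(3 : ℂ) ^ 6 * (pairCount x y r : ℂ) - 4 ^ L‖ ≤ 729 * (errA x y + errB x y) := by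
    rw [hdiff]
    calc ‖∑ t ∈ univ.erase 0, g t‖ ≤ ∑ t ∈ univ.erase 0, ‖g t‖ := norm_sum_le _ _
      _ ≤ ∑ t ∈ univ.erase (0 : Fin 6 → Fin 3), (errA x y + errB x y) := by
          refine Finset.sum_le_sum fun t ht => ?_
          have ht0 : t ≠ 0 := Finset.ne_of_mem_erase ht
          rw [hg]
          beta_reduce
          rw [norm_mul, norm_pow, norm_omega3, one_pow, one_mul, norm_prod]
          exact prod_norm_factor_bit6_le x y t ht0
      _ ≤ ∑ _t : Fin 6 → Fin 3, (errA x y + errB x y) :=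
          Finset.sum_le_sum_of_subset_of_nonneg (Finset.erase_subset _ _)
            fun t _ _ => add_nonneg (errA_nonneg x y) (errB_nonneg x y)
      _ = 729 * (errA x y + errB x y) := by
          rw [Finset.sum_const, Finset.card_univ, Fintype.card_fun, Fintype.card_fin,
            Fintype.card_fin, nsmul_eq_mul]
          norm_num
  have hreal : (3 : ℂ) ^ 6 * (pairCount x y r : ℂ) - 4 ^ L =
      ((729 * (pairCount x y r : ℝ) - 4 ^ L : ℝ) : ℂ) := by
    push_cast; ring
  rw [hreal, Complex.norm_real, Real.norm_eq_abs] at hnorm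
  exact hnorm

/-- Hence the two-sided bounds used below. -/
theorem pairCount_ge (x y : Fin L → Bool) (r : ℕ) :
    (4 : ℝ) ^ L / 729 - (errA x y + errB x y) ≤ (pairCount x y r : ℝ) := by
  have h := abs_pairCount_sub_le x y r
  rw [abs_le] at h
  have : (4 : ℝ) ^ L / 729 = (4 ^ L) / 729 := rfl
  linarith [h.1]

/-- upper bound for `P(x,y)`. [folklore] -/
theorem pairCount_le (x y : Fin L → Bool) (r : ℕ) :
    (pairCount x y r : ℝ) ≤ (4 : ℝ) ^ L / 729 + (errA x y + errB x y) := by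
  have h := abs_pairCount_sub_le x y r
  rw [abs_le] at h
  linarith [h.2]

/-! ### Pointwise xor identities for the re-parametrisations -/

section XorIdentities
variable (a b c w : Fin L → Bool)

/-- `x3` is symmetric (swap of the last two arguments). [folklore] -/
theorem x3_comm23 : x3 a b c = x3 a c b := by
  funext i; unfold x3; cases a i <;> cases b i <;> cases c i <;> rfl
/-- `x3` is symmetric (swap of the first two arguments). [folklore] -/
theorem x3_comm12 : x3 a b c = x3 b a c := by
  funext i; unfold x3; cases a i <;> cases b i <;> cases c i <;> rfl
/-- `x3` is symmetric (swap of the outer arguments). [folklore] -/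
theorem x3_comm13 : x3 a b c = x3 c b a := by
  funext i; unfold x3; cases a i <;> cases b i <;> cases c i <;> rfl
/-- `x3` is invariant under cyclic permutation. [folklore] -/
theorem x3_cyc : x3 a b c = x3 b c a := by
  funext i; unfold x3; cases a i <;> cases b i <;> cases c i <;> rfl
/-- `x3` is invariant under the other cyclic permutation. [folklore] -/
theorem x3_cyc2 : x3 a b c = x3 c a b := by
  funext i; unfold x3; cases a i <;> cases b i <;> cases c i <;> rfl
/-- cancellation `a ⊕ (a ⊕ b ⊕ w) ⊕ b = w`. [folklore] -/
theorem x3_cancel_mid : x3 a (x3 a b w) b = w := by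
  funext i; unfold x3; cases a i <;> cases b i <;> cases w i <;> rfl
/-- cancellation `a ⊕ b ⊕ (a ⊕ b ⊕ w) = w`. [folklore] -/
theorem x3_cancel_right : x3 a b (x3 a b w) = w := by
  funext i; unfold x3; cases a i <;> cases b i <;> cases w i <;> rfl
/-- substitution identity `(a⊕b⊕w) ⊕ b ⊕ c = a ⊕ w ⊕ c`. [folklore] -/
theorem x3_sub_I5 : x3 (x3 a b w) b c = x3 a w c := by
  funext i; unfold x3; cases a i <;> cases b i <;> cases c i <;> cases w i <;> rfl
/-- substitution identity `a ⊕ (a⊕b⊕w) ⊕ c = b ⊕ w ⊕ c`. [folklore] -/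
theorem x3_sub_I6 : x3 a (x3 a b w) c = x3 b w c := by
  funext i; unfold x3; cases a i <;> cases b i <;> cases c i <;> cases w i <;> rfl
/-- substitution identity `c ⊕ b ⊕ (a⊕b⊕w) = c ⊕ a ⊕ w`. [folklore] -/
theorem x3_sub_I8 : x3 c b (x3 a b w) = x3 c a w := by
  funext i; unfold x3; cases a i <;> cases b i <;> cases c i <;> cases w i <;> rfl
/-- substitution identity `a ⊕ c ⊕ (a⊕b⊕w) = c ⊕ b ⊕ w`. [folklore] -/
theorem x3_sub_I9 : x3 a c (x3 a b w) = x3 c b w := by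
  funext i; unfold x3; cases a i <;> cases b i <;> cases c i <;> cases w i <;> rfl
/-- substitution identity `c ⊕ a ⊕ (a⊕b⊕w) = c ⊕ b ⊕ w`. [folklore] -/
theorem x3_sub_I10 : x3 c a (x3 a b w) = x3 c b w := by
  funext i; unfold x3; cases a i <;> cases b i <;> cases c i <;> cases w i <;> rfl
/-- substitution identity `b ⊕ c ⊕ (a⊕b⊕w) = c ⊕ a ⊕ w`. [folklore] -/
theorem x3_sub_I11 : x3 b c (x3 a b w) = x3 c a w := by
  funext i; unfold x3; cases a i <;> cases b i <;> cases c i <;> cases w i <;> rfl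

end XorIdentities

/-- `x3 a b w` is literally the translate `(a ⊕ b) ⊕ w`. -/
theorem x3_eq_xorLeft (a b w : Fin L → Bool) :
    x3 a b w = fun i => xor ((fun i => xor (a i) (b i)) i) (w i) := rfl

/-- equivalent conditions have equal `0/1` indicators. [folklore] -/
theorem ite_congr_nat {P Q : Prop} [Decidable P] [Decidable Q] (h : P ↔ Q) :
    (if P then (1 : ℕ) else 0) = if Q then 1 else 0 := by
  by_cases hp : P
  · rw [if_pos hp, if_pos (h.1 hp)]
  · rw [if_neg hp, if_neg fun hq => hp (h.2 hq)]

end CubeTwo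

end Summit.QuantumAdvantage.AdviceFreeQNC0

end
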